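import Summits.ResolutionOfSingularities.ResolutionOfSingularities.Theorems.FrobeniusLadderFInjectiveMacaulayficationX2YGBlowupRegularLocal
import HarnessLib

/-!
# (T-I3, habitat #3a centre side, part 1) GENERAL-`H` STRICT-TRANSFORM CHART LEMMAS AND THE EXCEPTIONAL PARTS `A[T]/(T_j² + C a)`, `A[T]/(1 + T_j²·C a)`
# (crux `FInjectiveMacaulayfication` stmt-ResolutionOfSingularities-15315, chain w45a; `Lines/T-I3-firststep.md` §3 #3a «a 2-generator strict-transform package for c₀² = −c₁²·w»:
# the strict transforms `T₀² + g`, `1 + T₁²g` of the pinch model are NOT of graph type, so `StrictTransformGraphType` is extended; seat res-L1-w45a-lead-1 g11)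

[OURS · L1 W4.5a] Support file (`--supports stmt-ResolutionOfSingularities-15315 --as helper`); def-free; UNCONDITIONAL; no named fact; NOT a statement of any manuscript. Commutative
algebra only; a tool for the next T″ habitat. Evidence for nothing beyond itself; T″ and the F-half OPEN; nothing of the crux proved. AI-written (AI review is weaker than expert review).

* §1 `nonempty_ringEquiv_quotient_sup_gen` (`B/((xᵢ) + (eval H)) ≅ (R/I)[T_j : j ≠ i]/(H̄)` for ANY `H`; Stacks 0BIQ), ★ `isRegularRing_quotient_eval_of_parts` (`B/(eval H)` regular from
  `eval H ∉ (xᵢ/1)`, the exceptional part `(R/I)[T]/(H̄)` and the open part `L/(eval H)L`), `isRegularRing_map_of_ringEquiv` (transport of the exceptional part along `A ≅ R/I`,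
  stated over an abstract `R` so that the nested quotient types are elaborated once).
* §2 ★ `isRegularRing_quotient_X_sq_add_C` (`A` regular ∋ ½, pointwise derivations on `V(a)`), `isRegularRing_quotient_one_add_X_sq_mul_C` (`A` regular ∋ ½).
[folklore; cite: Liu2002, Thm. 8.1.19 (a)] [cite: StacksProject, Tag 0BIQ; Tag 07Z3; Tag 07PF]
-/

-- single-problem summit: the doubled namespace component is forced
set_option linter.dupNamespace false

noncomputable section

namespace Summit.ResolutionOfSingularities.ResolutionOfSingularities.Theorems.FInjectiveMacaulayfication.PinchStrictTransformChart

open MvPolynomial Literature.AlgebraicGeometry.Resolution AlgebraicGeometry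
open Summit.ResolutionOfSingularities.ResolutionOfSingularities.Theorems.FInjectiveMacaulayfication
open Summit.ResolutionOfSingularities.ResolutionOfSingularities.Theorems.EquisingularLift.SpecimenQuartic (isRegularRing_quotient_of_derivations)
open StrictTransformGraphType

universe u v

/-! ## §1 General-`H` chart lemmas -/

section general

variable {R : Type u} [CommRing R] {r : ℕ} (x : Fin r → R) (i : Fin r)

/-- **`B/((xᵢ) + (eval H)) ≅ (R/I)[T_j : j ≠ i]/(H̄)`** for ANY polynomial `H` in the chart variables (Stacks 0BIQ: the relations of `B = R[I/xᵢ]` modulo `xᵢ` are `I·R[T]`). The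
graph-type case is `StrictTransformGraphType.nonempty_ringEquiv_quotient_sup`; the proof is the same. [cite: StacksProject, Tag 0BIQ] -/
theorem nonempty_ringEquiv_quotient_sup_gen (hx : IsQuasiRegular x) (H : MvPolynomial {j : Fin r // j ≠ i} R) :
    Nonempty ((blowupAlgebra (Ideal.span (Set.range x)) (x i) ⧸
        (Ideal.span {algebraMap R (blowupAlgebra (Ideal.span (Set.range x)) (x i)) (x i)} ⊔ Ideal.span {blowupAlgebra.eval x i H})) ≃+*
      (MvPolynomial {j : Fin r // j ≠ i} (R ⧸ Ideal.span (Set.range x)) ⧸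
        Ideal.span {MvPolynomial.map (Ideal.Quotient.mk (Ideal.span (Set.range x))) H})) := by
  classical
  have hMC : (Ideal.map (C : R →+* MvPolynomial {j : Fin r // j ≠ i} R) (Ideal.span (Set.range x))).map (blowupAlgebra.eval x i).toRingHom =
      Ideal.span {algebraMap R (blowupAlgebra (Ideal.span (Set.range x)) (x i)) (x i)} := by
    rw [Ideal.map_map]
    have hcomp : (blowupAlgebra.eval x i).toRingHom.comp C = algebraMap R (blowupAlgebra (Ideal.span (Set.range x)) (x i)) :=
      RingHom.ext fun c => blowupAlgebra.eval_C x i c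
    rw [hcomp, map_blowupAlgebra_eq_span (blowupAlgebra.mem_span_range x i)]
  have hM : (Ideal.map C (Ideal.span (Set.range x)) ⊔ Ideal.span {H}).map (blowupAlgebra.eval x i).toRingHom =
      Ideal.span {algebraMap R (blowupAlgebra (Ideal.span (Set.range x)) (x i)) (x i)} ⊔ Ideal.span {blowupAlgebra.eval x i H} := by
    rw [Ideal.map_sup, hMC, Ideal.map_span, Set.image_singleton]; rfl
  have hker : RingHom.ker (blowupAlgebra.eval x i).toRingHom ≤ Ideal.map C (Ideal.span (Set.range x)) ⊔ Ideal.span {H} := by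
    refine le_trans ?_ le_sup_left
    rw [RingHom.ker_eq_comap_bot, ← blowupAlgebra.comap_eval_span_algebraMap_eq x i hx]
    exact Ideal.comap_mono bot_le
  have e2 := (Ideal.quotEquivOfEq hM.symm).trans (blowupAlgebra.quotientMapEvalEquiv x i hker)
  have hsurj : Function.Surjective (MvPolynomial.map (σ := {j : Fin r // j ≠ i}) (Ideal.Quotient.mk (Ideal.span (Set.range x)))) :=
    map_surjective _ Ideal.Quotient.mk_surjective
  have hg : Function.Surjective ((Ideal.Quotient.mk (Ideal.span {MvPolynomial.map (Ideal.Quotient.mk (Ideal.span (Set.range x))) H})).comp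
      (MvPolynomial.map (σ := {j : Fin r // j ≠ i}) (Ideal.Quotient.mk (Ideal.span (Set.range x))))) :=
    Ideal.Quotient.mk_surjective.comp hsurj
  have hkerg : RingHom.ker ((Ideal.Quotient.mk (Ideal.span {MvPolynomial.map (Ideal.Quotient.mk (Ideal.span (Set.range x))) H})).comp
      (MvPolynomial.map (σ := {j : Fin r // j ≠ i}) (Ideal.Quotient.mk (Ideal.span (Set.range x))))) =
      Ideal.map C (Ideal.span (Set.range x)) ⊔ Ideal.span {H} := by
    have hspan : Ideal.span {MvPolynomial.map (Ideal.Quotient.mk (Ideal.span (Set.range x))) H} =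
        (Ideal.span {H}).map (MvPolynomial.map (σ := {j : Fin r // j ≠ i}) (Ideal.Quotient.mk (Ideal.span (Set.range x)))) := by
      rw [Ideal.map_span (MvPolynomial.map (σ := {j : Fin r // j ≠ i}) (Ideal.Quotient.mk (Ideal.span (Set.range x)))), Set.image_singleton]
    rw [← RingHom.comap_ker, Ideal.mk_ker, hspan, Ideal.comap_map_of_surjective _ hsurj, ← RingHom.ker_eq_comap_bot, MvPolynomial.ker_map,
      Ideal.mk_ker, sup_comm]
  have e34 := (Ideal.quotEquivOfEq hkerg.symm).trans (RingHom.quotientKerEquivOfSurjective hg)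
  exact ⟨e2.trans e34⟩

/-- ★ **`B/(eval H)` is a regular ring from its exceptional and open parts** (`R` Noetherian, `x` quasi-regular): if `eval H ∉ (xᵢ/1)`, the exceptional part
`(R/I)[T_j : j ≠ i]/(H̄)` is a regular ring, and the open part `L/(eval H)·L` (`L = R[1/xᵢ]`) is a regular ring, then `B/(eval H)` is a regular ring. [folklore; cite: Liu2002, Thm. 8.1.19 (a)] -/
theorem isRegularRing_quotient_eval_of_parts [IsNoetherianRing R] (hx : IsQuasiRegular x) [IsDomain (R ⧸ Ideal.span (Set.range x))] (H : MvPolynomial {j : Fin r // j ≠ i} R)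
    (hH : blowupAlgebra.eval x i H ∉ Ideal.span {algebraMap R (blowupAlgebra (Ideal.span (Set.range x)) (x i)) (x i)})
    (hE : IsRegularRing (MvPolynomial {j : Fin r // j ≠ i} (R ⧸ Ideal.span (Set.range x)) ⧸
      Ideal.span {MvPolynomial.map (Ideal.Quotient.mk (Ideal.span (Set.range x))) H}))
    (hoff : IsRegularRing (Localization.Away (x i) ⧸
      (Ideal.span {blowupAlgebra.eval x i H}).map (algebraMap (blowupAlgebra (Ideal.span (Set.range x)) (x i)) (Localization.Away (x i))))) :
    IsRegularRing (blowupAlgebra (Ideal.span (Set.range x)) (x i) ⧸ Ideal.span {blowupAlgebra.eval x i H}) := by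
  classical
  haveI : IsNoetherianRing (blowupAlgebra (Ideal.span (Set.range x)) (x i)) := isNoetherianRing_blowupAlgebra x i
  have hnzd := mk_mem_nonZeroDivisors_of_not_mem (blowupAlgebra.isPrime_span_algebraMap x i hx)
    (algebraMap_mem_nonZeroDivisors_blowupAlgebra (I := Ideal.span (Set.range x)) (a := x i)) hH
  have hE' : IsRegularRing (blowupAlgebra (Ideal.span (Set.range x)) (x i) ⧸
      (Ideal.span {algebraMap R (blowupAlgebra (Ideal.span (Set.range x)) (x i)) (x i)} ⊔ Ideal.span {blowupAlgebra.eval x i H})) := by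
    obtain ⟨e⟩ := nonempty_ringEquiv_quotient_sup_gen x i hx H
    haveI := hE
    exact IsRegularRing.of_ringEquiv (R := MvPolynomial {j : Fin r // j ≠ i} (R ⧸ Ideal.span (Set.range x)) ⧸
      Ideal.span {MvPolynomial.map (Ideal.Quotient.mk (Ideal.span (Set.range x))) H}) e.symm
  haveI := isLocalization_away_quotient x i (blowupAlgebra.eval x i H)
  exact isRegularRing_quotient_of_sup_of_away _ _ hnzd hE' hoff

/-- **Transport of the exceptional part along an isomorphism of coefficient rings** `e : A ≃ R/I`: if `H̄ = e_*(F)` and `A[T]/(F)` is a regular ring then so is `(R/I)[T]/(H̄)`.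
[plumbing] -/
theorem isRegularRing_map_of_ringEquiv {A : Type u} [CommRing A] (e : A ≃+* R ⧸ Ideal.span (Set.range x)) (F : MvPolynomial {j : Fin r // j ≠ i} A)
    (H : MvPolynomial {j : Fin r // j ≠ i} R)
    (hHF : MvPolynomial.map (Ideal.Quotient.mk (Ideal.span (Set.range x))) H = MvPolynomial.map (e : A →+* R ⧸ Ideal.span (Set.range x)) F)
    (hF : IsRegularRing (MvPolynomial {j : Fin r // j ≠ i} A ⧸ Ideal.span {F})) :
    IsRegularRing (MvPolynomial {j : Fin r // j ≠ i} (R ⧸ Ideal.span (Set.range x)) ⧸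
      Ideal.span {MvPolynomial.map (Ideal.Quotient.mk (Ideal.span (Set.range x))) H}) := by
  haveI := hF
  rw [hHF]
  exact IsRegularRing.of_ringEquiv (R := MvPolynomial {j : Fin r // j ≠ i} A ⧸ Ideal.span {F})
    (Ideal.quotientEquiv _ _ (MvPolynomial.mapEquiv {j : Fin r // j ≠ i} e) (by rw [Ideal.map_span, Set.image_singleton]; rfl))

end general

/-! ## §2 The exceptional parts: `A[T]/(T_j² + C a)` and `A[T]/(1 + T_j²·C a)` are regular rings -/

section exceptional

variable {A : Type u} [CommRing A] {σ : Type} [Fintype σ]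

/-- ★ **`A[T_σ]/(T_j² + C a)` is a regular ring** for `A` regular ∋ ½ with pointwise derivations on `V(a)`: at `Q ∋ T_j² + a`, use `∂_{T_j}` (value `2T_j`) if `T_j ∉ Q`, else `a ∈ Q` and the
coefficientwise extension of a `D` with `D a ∉ Q ∩ A` (value `C(D a)`). [folklore; cite: StacksProject, Tag 07PF] -/
theorem isRegularRing_quotient_X_sq_add_C [IsRegularRing A] (h2 : IsUnit (2 : A)) {S₀ : Type v} [CommRing S₀] [Algebra S₀ A]
    (j : σ) (a : A) (hD : ∀ Q : Ideal A, Q.IsPrime → a ∈ Q → ∃ D : Derivation S₀ A A, D a ∉ Q) :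
    IsRegularRing (MvPolynomial σ A ⧸ Ideal.span {X j ^ 2 + C a}) := by
  refine isRegularRing_quotient_of_derivations (S₀ := S₀) (X j ^ 2 + C a : MvPolynomial σ A) fun Q hQ hF => ?_
  by_cases hX : (X j : MvPolynomial σ A) ∈ Q
  · have ha : (C a : MvPolynomial σ A) ∈ Q := by
      have := Q.sub_mem hF (Q.pow_mem_of_mem hX 2 (by norm_num))
      rwa [add_sub_cancel_left] at this
    haveI : (Q.comap (C : A →+* MvPolynomial σ A)).IsPrime := Ideal.comap_isPrime _ Q
    obtain ⟨D, hDa⟩ := hD (Q.comap (C : A →+* MvPolynomial σ A)) inferInstance (by rw [Ideal.mem_comap]; exact ha)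
    refine ⟨coeffwiseDerivation (ι := σ) D, ?_⟩
    rw [map_add, Derivation.leibniz_pow, coeffwiseDerivation_X, smul_zero, smul_zero, zero_add, coeffwiseDerivation_C]
    exact fun hmem => hDa (by rw [Ideal.mem_comap]; exact hmem)
  · refine ⟨(pderiv j : Derivation A (MvPolynomial σ A) (MvPolynomial σ A)).restrictScalars S₀, ?_⟩
    rw [Derivation.restrictScalars_apply, map_add, pderiv_C, add_zero, Derivation.leibniz_pow, pderiv_X_self]
    simp only [smul_eq_mul, mul_one, nsmul_eq_mul]
    rw [show (2 - 1 : ℕ) = 1 from rfl, pow_one]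
    intro hmem
    have hu2 : IsUnit ((2 : ℕ) : MvPolynomial σ A) := by
      rw [Nat.cast_ofNat, show (2 : MvPolynomial σ A) = C (2 : A) by rw [map_ofNat]]; exact h2.map C
    exact hX ((hQ.mem_or_mem hmem).resolve_left (ODPCurveBlowupRegular.not_mem_of_isUnit hQ hu2))

/-- ★ **`A[T_σ]/(1 + T_j²·C a)` is a regular ring** for `A` regular ∋ ½: at `Q ∋ 1 + T_j² a` both `T_j` and `C a` are units modulo `Q`, so `∂_{T_j}` (value `2T_j·C a`) works. [folklore] -/
theorem isRegularRing_quotient_one_add_X_sq_mul_C [IsRegularRing A] (h2 : IsUnit (2 : A)) (j : σ) (a : A) :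
    IsRegularRing (MvPolynomial σ A ⧸ Ideal.span {1 + X j ^ 2 * C a}) := by
  refine isRegularRing_quotient_of_derivations (S₀ := A) (1 + X j ^ 2 * C a : MvPolynomial σ A) fun Q hQ hF => ?_
  refine ⟨pderiv j, ?_⟩
  rw [map_add, Derivation.map_one_eq_zero, zero_add, Derivation.leibniz, pderiv_C, smul_zero, zero_add, Derivation.leibniz_pow, pderiv_X_self]
  simp only [smul_eq_mul, mul_one, nsmul_eq_mul]
  rw [show (2 - 1 : ℕ) = 1 from rfl, pow_one]
  intro hmem
  have hu2 : IsUnit ((2 : ℕ) : MvPolynomial σ A) := by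
    rw [Nat.cast_ofNat, show (2 : MvPolynomial σ A) = C (2 : A) by rw [map_ofNat]]; exact h2.map C
  -- `C a · (2 · T_j) ∈ Q` ⇒ `T_j ∈ Q ∨ C a ∈ Q` ⇒ `T_j²·C a ∈ Q` ⇒ `1 ∈ Q`
  have hsq : (X j ^ 2 * C a : MvPolynomial σ A) ∈ Q := by
    rcases hQ.mem_or_mem hmem with h1 | h1
    · exact Q.mul_mem_left _ h1
    · have hXj : (X j : MvPolynomial σ A) ∈ Q := (hQ.mem_or_mem h1).resolve_left (ODPCurveBlowupRegular.not_mem_of_isUnit hQ hu2)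
      exact Q.mul_mem_right _ (Q.pow_mem_of_mem hXj 2 (by norm_num))
  have h1 : (1 : MvPolynomial σ A) ∈ Q := by
    have := Q.sub_mem hF hsq
    rwa [add_sub_cancel_right] at this
  exact hQ.ne_top ((Ideal.eq_top_iff_one _).mpr h1)

end exceptional

end Summit.ResolutionOfSingularities.ResolutionOfSingularities.Theorems.FInjectiveMacaulayfication.PinchStrictTransformChart

end
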